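import Summits.BirchSwinnertonDyer.BirchSwinnertonDyer.Theorems.Rank1ResidualJetSection6BridgeMin
import Summits.BirchSwinnertonDyer.Rank1Residual.X11b.RingClassFieldNoTorsion
import HarnessLib

/-!
# T1 JET (cell `bsd-jet`), road K: Prop. 6.4 DISCHARGED from the reading binder K5 —
# K3 ∕ K1 ∕ K4 ⟸ McCallum 1991 Prop. 5.2 (typed) + K5 (Jetchev Prop. 5.3 read at `p ∣ N`) + ONE
# kernel hypothesis: [J] Thm. 5.2 (= arXiv Thm. 6.3) instantiated on the row objects

HONEST FRAMING (programme file §HONESTY, verbatim): «no tranche here proves BSD; ARM L moves the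
LITERAL column of an r ≤ 1 census into the kernel-proved-modulo-named-print column.» THEOREMS ONLY
(seat `bsd-jet-pv-2`, session g2; `--supports stmt-BirchSwinnertonDyer-14418`, helper); 0 classes
move; every binder stays `@[conjecture]`.

WHAT IS PROVED. The minimal bridge (`Rank1ResidualJetSection6BridgeMin.lean`, p487923) reduces the
reading binders to McCallum Prop. 5.2 + a hypothesis `H = (h64 ∧ h63)` for SOME core-vertex predicate.
Here `Core k c := Jetchev2008.IsGlobalCoreVertex W K ι τ p k c` (lit-ty's typed §5.2, p485508, `τ`
the non-trivial automorphism of `K/ℚ`) and: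
* `exists_coreVertex_of_coreVertexExistence` — the `h64` half of `H` FOLLOWS from the reading binder
  `JET.JetchevCoreVertexExistence` (K5 = printed Prop. 5.3 read at `p ∣ N`, `Rank1ResidualJetDefs.lean`,
  p487481): from `m(c) = m_∞` and the depth characterisation one extracts a datum of EXACT depth `m_∞`;
  its derived point is non-torsion because `E(K[c])[p] = 0` (x11b3's kernel theorem
  `X11b.RingClassNoTorsion.torsionBy_ringClassField_eq_bot`, from the tower at `n = 1`) and a torsion
  point of order prime to `p` is `p^u`-divisible for every `u`
  (`exists_pow_smul_eq_of_isOfFinAddOrder`); K5 then yields `c' ∈ Λ_{k+m_∞}`, a core vertex with a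
  datum not divisible to depth `m_∞ + 1`, i.e. `m(c') ≤ m_∞`.
* `jetchevDivisibilityCarrierMult_of_prop52_of_coreVertexExistence` (and `…Ne…`, `…Add…`) — K3 ∕ K1 ∕
  K4 ⟸ `h52` (McCallum 5.2, typed fact) + `hCV` (K5) + `hRCF` («ring class fields of an imaginary
  quadratic field are number fields» — the instance binder K5 carries; true by
  `finiteDimensional_and_isGalois_ringClassField`, kept as a named hypothesis) + `H63` = [J] Thm. 5.2
  for the row objects with `IsGlobalCoreVertex` — the ONE remaining kernel obligation (instantiate
  `JET.Section6.tamagawaExponent_le_mInfty_of_minimalCoreVertex`, p471669, via stubs S1/S3/S5/S6/S7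
  of `HOME/sheets/PV2-J6-KERNEL.md`; the complex conjugation `τ` is produced inside from
  `IsImaginaryQuadratic K`).
So the (J∣N) kernel line reads, in the kernel: K1 ∧ K3 ∧ K4 ⟸ {McCallum Prop. 5.2 (print), Jetchev
Prop. 5.3 read at `p ∣ N` (K5), ring class fields} + Thm. 5.2-instantiated. References:
[cite: Jetchev2008, Prop. 5.3 (p. 823), Thm. 5.2 (p. 821), Proof of Thm. 1.1 (p. 824)]
[cite: McCallumLMS1991, §5 Prop. 5.2 (p. 304); §4 (5)] [cite: GrossLMS1991, §4, Lemma 4.3].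
-/

set_option autoImplicit false

noncomputable section

open scoped Classical

open WeierstrassCurve Literature.NumberTheory.EllipticCurves
  Literature.NumberTheory.EllipticCurves.ModularForms

namespace Summit.BirchSwinnertonDyer.Rank1Residual.JET

/-- In an additive commutative group without `p`-torsion (element form: `p • R = 0 ⇒ R = 0`), a
point of finite order is `p^u`-divisible for every `u`: its order `N` is prime to `p` (else
`(N/p) • P` would be a non-zero `p`-torsion point), so some multiple of `p^u • P` is `P`. Elementary.
[cite: GrossLMS1991, §4, Lemma 4.3] -/
theorem exists_pow_smul_eq_of_isOfFinAddOrder {A : Type*} [AddCommGroup A]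
    {p : ℕ} (hp : p.Prime) (hA : ∀ R : A, (p : ℤ) • R = 0 → R = 0) {P : A}
    (hP : IsOfFinAddOrder P) (u : ℕ) : ∃ Q : A, ((p ^ u : ℕ) : ℤ) • Q = P := by
  have hN0 : 0 < addOrderOf P := hP.addOrderOf_pos
  -- `p ∤ addOrderOf P`
  have hndvd : ¬ p ∣ addOrderOf P := by
    rintro ⟨e, he⟩
    have he0 : 0 < e := by
      rcases Nat.eq_zero_or_pos e with h | h
      · rw [h, mul_zero] at he
        omega
      · exact h
    have hzero : e • P = 0 := by
      apply hA
      rw [natCast_zsmul, smul_smul, ← he]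
      exact addOrderOf_nsmul_eq_zero P
    have hdvd' : addOrderOf P ∣ e := addOrderOf_dvd_of_nsmul_eq_zero hzero
    have hle : addOrderOf P ≤ e := Nat.le_of_dvd he0 hdvd'
    have hlt : e < addOrderOf P := by
      rw [he]
      exact lt_mul_left he0 hp.one_lt
    omega
  have hcop : (p ^ u).Coprime (addOrderOf P) :=
    Nat.Coprime.pow_left u ((Nat.Prime.coprime_iff_not_dvd hp).mpr hndvd)
  obtain ⟨a, ha⟩ := exists_nsmul_eq_self_of_coprime hcop
  refine ⟨a • P, ?_⟩
  rw [natCast_zsmul, smul_comm, ha]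

/-- **Prop. 6.4 for the row objects from K5.** Under the binders of the reading binders and the depth
bookkeeping of the bridge (`mdiv` characterised by divisibility of the derived points, `m` from `mdiv`
and `M(c) = Zhang2014.levelIndex`), for every level `k ≥ 1` and conductor `c` with `m(c) = m_∞` and
`m_∞ + k ≤ M(c)`: a conductor `c' ∈ Λ_{k+m_∞}` which is a core vertex for `k`
(`Jetchev2008.IsGlobalCoreVertex`) with `m(c') ≤ m_∞` — the `h64` clause of
`derivedPoint_divisible_of_prop52_of_section6_min`. From `JET.JetchevCoreVertexExistence` (K5) applied
to a datum of exact depth `m_∞` (non-torsion by `E(K[c])[p] = 0`, x11b3).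
[cite: Jetchev2008, Prop. 5.3 (p. 823)] [cite: GrossLMS1991, §4, Lemma 4.3] -/
theorem exists_coreVertex_of_coreVertexExistence (hCV : JetchevCoreVertexExistence)
    (W : WeierstrassCurve ℚ) [W.IsElliptic] [W.IsGloballyMinimal] [NeZero (W.conductorNorm ℤ)]
    (hcm : ¬ W.HasCM) (K : Type) [Field K] [NumberField K] (hK : IsImaginaryQuadratic K)
    (hD3 : NumberField.discr K ≠ -3) (hD4 : NumberField.discr K ≠ -4)
    (hH : SatisfiesHeegnerHypothesis (W.conductorNorm ℤ) K)
    (τ : K ≃ₐ[ℚ] K) (hτ : τ ≠ 1)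
    (p : ℕ) [Fact p.Prime] (hp2 : p ≠ 2) (htower : ∀ n : ℕ, W.HasSurjectiveModNGaloisRep (p ^ n : ℕ))
    (Dt : ModularParametrizationData W (W.conductorNorm ℤ)) (β : ℤ) (ι : K →+* ℂ)
    [∀ k : ℕ, NumberField (ringClassField K ι k)]
    (d₁ : KolyvaginHeegnerData Dt β ι 1) (hy : ¬ IsOfFinAddOrder d₁.derivedPoint)
    (mdiv m : {c : ℕ // Squarefree c ∧ ∀ ℓ ∈ c.primeFactors,
      Zhang2014.IsKolyvaginPrime (W.conductorNorm ℤ) W K p ℓ} → ℕ∞)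
    (hchar : ∀ c (u : ℕ), (u : ℕ∞) ≤ mdiv c ↔ ∀ d : KolyvaginHeegnerData Dt β ι c.1,
      ∃ Q : (W.baseChange (ringClassField K ι c.1)).toAffine.Point,
        ((p ^ u : ℕ) : ℤ) • Q = d.derivedPoint)
    (hmdef : ∀ c, m c = if mdiv c < Zhang2014.levelIndex W p c.1 then mdiv c else ⊤)
    (mInf k : ℕ) (c : {c : ℕ // Squarefree c ∧ ∀ ℓ ∈ c.primeFactors,
      Zhang2014.IsKolyvaginPrime (W.conductorNorm ℤ) W K p ℓ})
    (hk : 1 ≤ k) (hmc : m c = mInf) (hMc : (mInf : ℕ∞) + k ≤ Zhang2014.levelIndex W p c.1) :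
    ∃ c' : {c : ℕ // Squarefree c ∧ ∀ ℓ ∈ c.primeFactors,
        Zhang2014.IsKolyvaginPrime (W.conductorNorm ℤ) W K p ℓ},
      Jetchev2008.IsGlobalCoreVertex W K ι τ p k c'.1 ∧
      (k : ℕ∞) + mInf ≤ Zhang2014.levelIndex W p c'.1 ∧ m c' ≤ mInf := by
  have hp : p.Prime := Fact.out
  -- `mdiv c = mInf < M(c)`
  have hlt : mdiv c < Zhang2014.levelIndex W p c.1 := by
    by_contra h
    rw [hmdef, if_neg h] at hmc
    exact ENat.top_ne_coe mInf hmc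
  have hmdiv : mdiv c = mInf := by rw [hmdef, if_pos hlt] at hmc; exact hmc
  -- a datum of exact depth `mInf`
  have hDv : ∀ d : KolyvaginHeegnerData Dt β ι c.1,
      ∃ Q : (W.baseChange (ringClassField K ι c.1)).toAffine.Point,
        ((p ^ mInf : ℕ) : ℤ) • Q = d.derivedPoint := (hchar c mInf).mp hmdiv.symm.le
  have hnotDv : ¬ ∀ d : KolyvaginHeegnerData Dt β ι c.1,
      ∃ Q : (W.baseChange (ringClassField K ι c.1)).toAffine.Point,
        ((p ^ (mInf + 1) : ℕ) : ℤ) • Q = d.derivedPoint := by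
    intro h
    have := (hchar c (mInf + 1)).mpr h
    rw [hmdiv, ENat.coe_le_coe] at this
    omega
  obtain ⟨d', hnd'⟩ := not_forall.mp hnotDv
  have hdiv' := hDv d'
  -- the derived point of `d'` is not torsion: `E(K[c])[p] = 0`
  have hc0 : c.1 ≠ 0 := c.2.1.ne_zero
  have hA : ∀ R : (W.baseChange (ringClassField K ι c.1)).toAffine.Point, (p : ℤ) • R = 0 → R = 0 :=
    fun R hR ↦ X11b.RingClassNoTorsion.eq_zero_of_zsmul_pow_eq_zero_ringClassField W hK ι hc0 hp hp2
      (by simpa using htower 1) 1 R (by simpa using hR)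
  have hnt : ¬ IsOfFinAddOrder d'.derivedPoint :=
    fun hfin ↦ hnd' (exists_pow_smul_eq_of_isOfFinAddOrder hp hA hfin (mInf + 1))
  -- `c ∈ Λ_{mInf + k}`
  have hsM : ((mInf + k : ℕ) : ℕ∞) ≤ Zhang2014.levelIndex W p c.1 := by push_cast; exact hMc
  -- K5
  obtain ⟨c', d'', hsq', hℓ', hcore, -, hnd''⟩ := hCV W hcm K hK hD3 hD4 hH τ hτ p hp2 htower Dt β ι
    d₁ hy k hk c.1 d' c.2.1 c.2.2 mInf hnt hdiv' hnd' hsM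
  let cc : {c : ℕ // Squarefree c ∧ ∀ ℓ ∈ c.primeFactors,
      Zhang2014.IsKolyvaginPrime (W.conductorNorm ℤ) W K p ℓ} := ⟨c', hsq', fun ℓ h ↦ (hℓ' ℓ h).1⟩
  have hM' : (k : ℕ∞) + mInf ≤ Zhang2014.levelIndex W p c' := by
    have := Zhang2014.natCast_le_levelIndex_iff.mpr fun ℓ h ↦ (hℓ' ℓ h).2
    push_cast at this
    exact this
  refine ⟨cc, hcore, hM', ?_⟩
  -- `m(c') ≤ mInf`: the datum `d''` is not divisible to depth `mInf + 1`
  have hle : mdiv cc ≤ mInf := by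
    have h1 : ¬ ((mInf + 1 : ℕ) : ℕ∞) ≤ mdiv cc := fun h ↦ hnd'' ((hchar cc (mInf + 1)).mp h d'')
    rw [not_le] at h1
    have h2 : mdiv cc < (mInf : ℕ∞) + 1 := by exact_mod_cast h1
    exact (ENat.lt_add_one_iff (ENat.coe_ne_top mInf)).mp h2
  have hlt' : mdiv cc < Zhang2014.levelIndex W p cc.1 := by
    refine lt_of_le_of_lt hle (lt_of_lt_of_le ?_ hM')
    have h1 : (mInf : ℕ∞) < (mInf : ℕ∞) + 1 :=
      (ENat.lt_add_one_iff (ENat.coe_ne_top mInf)).mpr le_rfl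
    calc (mInf : ℕ∞) < (mInf : ℕ∞) + 1 := h1
      _ ≤ (k : ℕ∞) + mInf := by
        rw [add_comm]
        exact add_le_add_left (by exact_mod_cast hk) _
  rw [hmdef, if_pos hlt']
  exact hle

/-- The non-trivial automorphism of an imaginary quadratic field (complex conjugation):
`Aut(K/ℚ)` has two elements. [cite: GrossLMS1991, §3 (τ = complex conjugation)] -/
theorem exists_algEquiv_ne_one_of_isImaginaryQuadratic (K : Type) [Field K] [NumberField K]
    (hK : IsImaginaryQuadratic K) : ∃ τ : K ≃ₐ[ℚ] K, τ ≠ 1 := by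
  haveI : Algebra.IsQuadraticExtension ℚ K := ⟨hK.1⟩
  have hcard : Nat.card (K ≃ₐ[ℚ] K) = 2 := by rw [IsGalois.card_aut_eq_finrank, hK.1]
  obtain ⟨y, hy, -⟩ := (Nat.card_eq_two_iff' (1 : K ≃ₐ[ℚ] K)).mp hcard
  exact ⟨y, hy⟩

/-- **K3 ⟸ McCallum Prop. 5.2 + K5 + ring class fields + [J] Thm. 5.2 instantiated.** The reading
binder `JetchevDivisibilityCarrierMult` follows from the typed fact
`McCallum1991.prop52_exists_conductor_kolyvaginClass_order_eq` (`h52`), the reading binder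
`JetchevCoreVertexExistence` (`hCV`, K5), the fact that the ring class fields of an imaginary
quadratic field are number fields (`hRCF`), and ONE kernel hypothesis `H63`: printed Thm. 5.2 (arXiv
Thm. 6.3) for the row objects — for every frame, depth bookkeeping `(mdiv, m, m_∞)` as in the bridge,
level `k ≥ 1` and conductor `c` which is a core vertex for `k` (`Jetchev2008.IsGlobalCoreVertex`, for the
complex conjugation `τ`) with `m(c) = m_∞`, `k + m_∞ ≤ M(c)`, `t < k`, `m_∞ < k`: `t ≤ m_∞`,
`t = ord_p c_p(E)`. Via `jetchevDivisibilityCarrierMult_of_prop52_of_section6_min` with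
`Core := IsGlobalCoreVertex` and `exists_coreVertex_of_coreVertexExistence`.
[cite: Jetchev2008, Prop. 5.3 (p. 823), Thm. 5.2 (p. 821), Proof of Thm. 1.1 (p. 824)]
[cite: McCallumLMS1991, §5 Prop. 5.2 (p. 304)] -/
theorem jetchevDivisibilityCarrierMult_of_prop52_of_coreVertexExistence
    (h52 : McCallum1991.prop52_exists_conductor_kolyvaginClass_order_eq)
    (hCV : JetchevCoreVertexExistence)
    (hRCF : ∀ (K : Type) [Field K] [NumberField K] (ι : K →+* ℂ), IsImaginaryQuadratic K →
      ∀ k : ℕ, NumberField (ringClassField K ι k))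
    (H63 : ∀ (W : WeierstrassCurve ℚ) [W.IsElliptic] [W.IsGloballyMinimal] [NeZero (W.conductorNorm ℤ)],
      ¬ W.HasCM → ∀ (K : Type) [Field K] [NumberField K], IsImaginaryQuadratic K →
      NumberField.discr K ≠ -3 → NumberField.discr K ≠ -4 →
      SatisfiesHeegnerHypothesis (W.conductorNorm ℤ) K →
      ∀ (τ : K ≃ₐ[ℚ] K), τ ≠ 1 →
      ∀ (p : ℕ) [Fact p.Prime], p ≠ 2 → W.HasMultiplicativeReductionAtPrime p →
      (∀ n : ℕ, W.HasSurjectiveModNGaloisRep (p ^ n : ℕ)) →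
      ∀ (Dt : ModularParametrizationData W (W.conductorNorm ℤ)) (β : ℤ) (ι : K →+* ℂ)
        [∀ k : ℕ, NumberField (ringClassField K ι k)]
        (d₁ : KolyvaginHeegnerData Dt β ι 1), ¬ IsOfFinAddOrder d₁.derivedPoint →
      ∀ (mdiv m : {c : ℕ // Squarefree c ∧ ∀ ℓ ∈ c.primeFactors,
          Zhang2014.IsKolyvaginPrime (W.conductorNorm ℤ) W K p ℓ} → ℕ∞),
      (∀ c (u : ℕ), (u : ℕ∞) ≤ mdiv c ↔ ∀ d : KolyvaginHeegnerData Dt β ι c.1,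
        ∃ Q : (W.baseChange (ringClassField K ι c.1)).toAffine.Point,
          ((p ^ u : ℕ) : ℤ) • Q = d.derivedPoint) →
      (∀ c, m c = if mdiv c < Zhang2014.levelIndex W p c.1 then mdiv c else ⊤) →
      ∀ mInf : ℕ, (∀ c, (mInf : ℕ∞) ≤ m c) →
        (∀ m' : ℕ, ∃ c, (m' : ℕ∞) ≤ Zhang2014.levelIndex W p c.1 ∧ m c = mInf) →
      ∀ (k : ℕ) c, 1 ≤ k → Jetchev2008.IsGlobalCoreVertex W K ι τ p k c.1 → m c = mInf →
        (k : ℕ∞) + mInf ≤ Zhang2014.levelIndex W p c.1 →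
        padicValNat p ((W.baseChange ℚ_[p]).localTamagawaNumber ℤ_[p]) < k → mInf < k →
        padicValNat p ((W.baseChange ℚ_[p]).localTamagawaNumber ℤ_[p]) ≤ mInf) :
    JetchevDivisibilityCarrierMult := by
  refine jetchevDivisibilityCarrierMult_of_prop52_of_section6_min h52 ?_
  intro W _ _ _ hcm K _ _ hK hD3 hD4 hH p _ hp2 hmult htower Dt β ι d₁ hy mdiv m hchar hmdef mInf
    hmInf hKoly
  obtain ⟨τ, hτ⟩ := exists_algEquiv_ne_one_of_isImaginaryQuadratic K hK
  haveI : ∀ k : ℕ, NumberField (ringClassField K ι k) := hRCF K ι hK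
  exact ⟨fun k c ↦ Jetchev2008.IsGlobalCoreVertex W K ι τ p k c.1,
    fun k c hk hmc hMc ↦ exists_coreVertex_of_coreVertexExistence hCV W hcm K hK hD3 hD4 hH τ hτ p
      hp2 htower Dt β ι d₁ hy mdiv m hchar hmdef mInf k c hk hmc hMc,
    fun k c hk hcore hmc hMc htk hik ↦ H63 W hcm K hK hD3 hD4 hH τ hτ p hp2 hmult htower Dt β ι d₁
      hy mdiv m hchar hmdef mInf hmInf hKoly k c hk hcore hmc hMc htk hik⟩

/-- **K1 ⟸ McCallum Prop. 5.2 + K5 + ring class fields + [J] Thm. 5.2 instantiated** (carrier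
`q ∣ N`, `q ≠ p`, `t = ord_p c_q(E)`). As `jetchevDivisibilityCarrierMult_of_prop52_of_coreVertexExistence`.
[cite: Jetchev2008, Prop. 5.3 (p. 823), Thm. 5.2 (p. 821), Proof of Thm. 1.1 (p. 824)]
[cite: McCallumLMS1991, §5 Prop. 5.2 (p. 304)] -/
theorem jetchevDivisibilityCarrierNe_of_prop52_of_coreVertexExistence
    (h52 : McCallum1991.prop52_exists_conductor_kolyvaginClass_order_eq)
    (hCV : JetchevCoreVertexExistence)
    (hRCF : ∀ (K : Type) [Field K] [NumberField K] (ι : K →+* ℂ), IsImaginaryQuadratic K →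
      ∀ k : ℕ, NumberField (ringClassField K ι k))
    (H63 : ∀ (W : WeierstrassCurve ℚ) [W.IsElliptic] [W.IsGloballyMinimal] [NeZero (W.conductorNorm ℤ)],
      ¬ W.HasCM → ∀ (K : Type) [Field K] [NumberField K], IsImaginaryQuadratic K →
      NumberField.discr K ≠ -3 → NumberField.discr K ≠ -4 →
      SatisfiesHeegnerHypothesis (W.conductorNorm ℤ) K →
      ∀ (τ : K ≃ₐ[ℚ] K), τ ≠ 1 →
      ∀ (p : ℕ) [Fact p.Prime], p ≠ 2 → (∀ n : ℕ, W.HasSurjectiveModNGaloisRep (p ^ n : ℕ)) →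
      ∀ (Dt : ModularParametrizationData W (W.conductorNorm ℤ)) (β : ℤ) (ι : K →+* ℂ)
        [∀ k : ℕ, NumberField (ringClassField K ι k)]
        (d₁ : KolyvaginHeegnerData Dt β ι 1), ¬ IsOfFinAddOrder d₁.derivedPoint →
      ∀ (q : ℕ) [Fact q.Prime], q ∣ W.conductorNorm ℤ → q ≠ p →
      ∀ (mdiv m : {c : ℕ // Squarefree c ∧ ∀ ℓ ∈ c.primeFactors,
          Zhang2014.IsKolyvaginPrime (W.conductorNorm ℤ) W K p ℓ} → ℕ∞),
      (∀ c (u : ℕ), (u : ℕ∞) ≤ mdiv c ↔ ∀ d : KolyvaginHeegnerData Dt β ι c.1,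
        ∃ Q : (W.baseChange (ringClassField K ι c.1)).toAffine.Point,
          ((p ^ u : ℕ) : ℤ) • Q = d.derivedPoint) →
      (∀ c, m c = if mdiv c < Zhang2014.levelIndex W p c.1 then mdiv c else ⊤) →
      ∀ mInf : ℕ, (∀ c, (mInf : ℕ∞) ≤ m c) →
        (∀ m' : ℕ, ∃ c, (m' : ℕ∞) ≤ Zhang2014.levelIndex W p c.1 ∧ m c = mInf) →
      ∀ (k : ℕ) c, 1 ≤ k → Jetchev2008.IsGlobalCoreVertex W K ι τ p k c.1 → m c = mInf →
        (k : ℕ∞) + mInf ≤ Zhang2014.levelIndex W p c.1 →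
        padicValNat p ((W.baseChange ℚ_[q]).localTamagawaNumber ℤ_[q]) < k → mInf < k →
        padicValNat p ((W.baseChange ℚ_[q]).localTamagawaNumber ℤ_[q]) ≤ mInf) :
    JetchevDivisibilityCarrierNe := by
  refine jetchevDivisibilityCarrierNe_of_prop52_of_section6_min h52 ?_
  intro W _ _ _ hcm K _ _ hK hD3 hD4 hH p _ hp2 htower Dt β ι d₁ hy q _ hqN hqp mdiv m hchar hmdef mInf
    hmInf hKoly
  obtain ⟨τ, hτ⟩ := exists_algEquiv_ne_one_of_isImaginaryQuadratic K hK
  haveI : ∀ k : ℕ, NumberField (ringClassField K ι k) := hRCF K ι hK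
  exact ⟨fun k c ↦ Jetchev2008.IsGlobalCoreVertex W K ι τ p k c.1,
    fun k c hk hmc hMc ↦ exists_coreVertex_of_coreVertexExistence hCV W hcm K hK hD3 hD4 hH τ hτ p
      hp2 htower Dt β ι d₁ hy mdiv m hchar hmdef mInf k c hk hmc hMc,
    fun k c hk hcore hmc hMc htk hik ↦ H63 W hcm K hK hD3 hD4 hH τ hτ p hp2 htower Dt β ι d₁ hy q
      hqN hqp mdiv m hchar hmdef mInf hmInf hKoly k c hk hcore hmc hMc htk hik⟩

/-- **K4 ⟸ McCallum Prop. 5.2 + K5 + ring class fields + [J] Thm. 5.2 instantiated** (carrier `p`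
additive, `t = ord_p c_p(E)`). As `jetchevDivisibilityCarrierMult_of_prop52_of_coreVertexExistence`.
[cite: Jetchev2008, Prop. 5.3 (p. 823), Thm. 5.2 (p. 821), Proof of Thm. 1.1 (p. 824)]
[cite: McCallumLMS1991, §5 Prop. 5.2 (p. 304)] -/
theorem jetchevDivisibilityCarrierAdd_of_prop52_of_coreVertexExistence
    (h52 : McCallum1991.prop52_exists_conductor_kolyvaginClass_order_eq)
    (hCV : JetchevCoreVertexExistence)
    (hRCF : ∀ (K : Type) [Field K] [NumberField K] (ι : K →+* ℂ), IsImaginaryQuadratic K →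
      ∀ k : ℕ, NumberField (ringClassField K ι k))
    (H63 : ∀ (W : WeierstrassCurve ℚ) [W.IsElliptic] [W.IsGloballyMinimal] [NeZero (W.conductorNorm ℤ)],
      ¬ W.HasCM → ∀ (K : Type) [Field K] [NumberField K], IsImaginaryQuadratic K →
      NumberField.discr K ≠ -3 → NumberField.discr K ≠ -4 →
      SatisfiesHeegnerHypothesis (W.conductorNorm ℤ) K →
      ∀ (τ : K ≃ₐ[ℚ] K), τ ≠ 1 →
      ∀ (p : ℕ) [Fact p.Prime], p ≠ 2 →
      ¬ W.HasGoodReductionAtPrime p → ¬ W.HasMultiplicativeReductionAtPrime p →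
      (∀ n : ℕ, W.HasSurjectiveModNGaloisRep (p ^ n : ℕ)) →
      ∀ (Dt : ModularParametrizationData W (W.conductorNorm ℤ)) (β : ℤ) (ι : K →+* ℂ)
        [∀ k : ℕ, NumberField (ringClassField K ι k)]
        (d₁ : KolyvaginHeegnerData Dt β ι 1), ¬ IsOfFinAddOrder d₁.derivedPoint →
      ∀ (mdiv m : {c : ℕ // Squarefree c ∧ ∀ ℓ ∈ c.primeFactors,
          Zhang2014.IsKolyvaginPrime (W.conductorNorm ℤ) W K p ℓ} → ℕ∞),
      (∀ c (u : ℕ), (u : ℕ∞) ≤ mdiv c ↔ ∀ d : KolyvaginHeegnerData Dt β ι c.1,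
        ∃ Q : (W.baseChange (ringClassField K ι c.1)).toAffine.Point,
          ((p ^ u : ℕ) : ℤ) • Q = d.derivedPoint) →
      (∀ c, m c = if mdiv c < Zhang2014.levelIndex W p c.1 then mdiv c else ⊤) →
      ∀ mInf : ℕ, (∀ c, (mInf : ℕ∞) ≤ m c) →
        (∀ m' : ℕ, ∃ c, (m' : ℕ∞) ≤ Zhang2014.levelIndex W p c.1 ∧ m c = mInf) →
      ∀ (k : ℕ) c, 1 ≤ k → Jetchev2008.IsGlobalCoreVertex W K ι τ p k c.1 → m c = mInf →
        (k : ℕ∞) + mInf ≤ Zhang2014.levelIndex W p c.1 →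
        padicValNat p ((W.baseChange ℚ_[p]).localTamagawaNumber ℤ_[p]) < k → mInf < k →
        padicValNat p ((W.baseChange ℚ_[p]).localTamagawaNumber ℤ_[p]) ≤ mInf) :
    JetchevDivisibilityCarrierAdd := by
  refine jetchevDivisibilityCarrierAdd_of_prop52_of_section6_min h52 ?_
  intro W _ _ _ hcm K _ _ hK hD3 hD4 hH p _ hp2 hgood hmult htower Dt β ι d₁ hy mdiv m hchar hmdef
    mInf hmInf hKoly
  obtain ⟨τ, hτ⟩ := exists_algEquiv_ne_one_of_isImaginaryQuadratic K hK
  haveI : ∀ k : ℕ, NumberField (ringClassField K ι k) := hRCF K ι hK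
  exact ⟨fun k c ↦ Jetchev2008.IsGlobalCoreVertex W K ι τ p k c.1,
    fun k c hk hmc hMc ↦ exists_coreVertex_of_coreVertexExistence hCV W hcm K hK hD3 hD4 hH τ hτ p
      hp2 htower Dt β ι d₁ hy mdiv m hchar hmdef mInf k c hk hmc hMc,
    fun k c hk hcore hmc hMc htk hik ↦ H63 W hcm K hK hD3 hD4 hH τ hτ p hp2 hgood hmult htower Dt β ι
      d₁ hy mdiv m hchar hmdef mInf hmInf hKoly k c hk hcore hmc hMc htk hik⟩

end Summit.BirchSwinnertonDyer.Rank1Residual.JET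

end
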